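import Mathlib.LinearAlgebra.Vandermonde
import Mathlib.LinearAlgebra.Matrix.NonsingularInverse
import Mathlib.Algebra.MvPolynomial.Basic
import Mathlib.Algebra.MvPolynomial.Eval
import Mathlib.Data.Real.Basic
import Mathlib.Analysis.SpecialFunctions.Pow.Real
import HarnessLib

/-!
# Route `ColdStartUniversality`, crux K_A1 `UniformColdStartMixing` (stmt-QuantumFields-24809), rung `stub_fixedCutoffMixing`:
# G-block, brick N5 (algebraic core) — polynomials are finite sums of ridge powers (polarization)

Helper file (seat `ym-line-csu-p1`, g7).  On `ι → ℝ` (`ι` finite) every polynomial function is a finite linear combination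
of ridge powers `x ↦ ⟨v, x⟩^k` (`eval_mvPolynomial_eq_sum_ridge_pow`).  The key step `x_i ⟨v,x⟩^k ∈ span` extracts the
linear Taylor coefficient of `ε ↦ ⟨v + ε e_i, x⟩^{k+1}` from its values at `k+2` nodes by inverting a Vandermonde matrix
(`exists_coord_mul_ridge_pow`).  With the one-variable Chebyshev span (`exists_sum_gegenbauerSum_eq_polynomial`) this makes the
span of products of latitude eigenfunctions an algebra containing all polynomial observables — the density /
multiplier-closure input of the ground-state arguments.  Pure algebra; no definition, no sorry.  RECORD-rung R3 plumbing.
-/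

set_option autoImplicit false

noncomputable section

namespace Summit.QuantumFields.YangMills.Theorems.ColdStartUniversality

open Finset Matrix
open scoped BigOperators

/-- **Extraction of `x_i ⟨v,x⟩^k` from ridge powers** (Vandermonde inversion at the nodes `0,1,…,k+1`):
`x_i ⟨v,x⟩^k = Σ_l a_l ⟨v + l e_i, x⟩^{k+1}`. [folklore] -/
theorem exists_coord_mul_ridge_pow {ι : Type*} [Fintype ι] [DecidableEq ι] (v : ι → ℝ) (i : ι) (k : ℕ) :
    ∃ a : Fin (k + 2) → ℝ, ∀ x : ι → ℝ,
      x i * (∑ j, v j * x j) ^ k =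
        ∑ l : Fin (k + 2), a l * (∑ j, (v + ((l : ℕ) : ℝ) • (Pi.single i (1 : ℝ) : ι → ℝ)) j * x j) ^ (k + 1) := by
  classical
  -- Vandermonde at the nodes `0, …, k+1`
  set ε : Fin (k + 2) → ℝ := fun l => ((l : ℕ) : ℝ) with hε
  have hinj : Function.Injective ε := fun l l' h => by
    simp only [hε] at h
    exact Fin.ext (by exact_mod_cast h)
  set M : Matrix (Fin (k + 2)) (Fin (k + 2)) ℝ := Matrix.vandermonde ε with hM
  have hdet : M.det ≠ 0 := (Matrix.det_vandermonde_ne_zero_iff).2 hinj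
  have hunit : IsUnit M.det := isUnit_iff_ne_zero.2 hdet
  have hone_lt : 1 < k + 2 := by omega
  set b : Fin (k + 2) → ℝ := Matrix.vecMul (Pi.single (⟨1, hone_lt⟩ : Fin (k + 2)) 1) M⁻¹ with hb
  have hbM : Matrix.vecMul b M = Pi.single (⟨1, hone_lt⟩ : Fin (k + 2)) 1 := by
    rw [hb, Matrix.vecMul_vecMul, Matrix.nonsing_inv_mul _ hunit, Matrix.vecMul_one]
  -- moments of `b`: `Σ_l b_l ε_l^m = [m = 1]`
  have hmom : ∀ m : ℕ, ∀ hm : m < k + 2, ∑ l, b l * ε l ^ m = if m = 1 then 1 else 0 := by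
    intro m hm
    have h := congrFun hbM ⟨m, hm⟩
    rw [Matrix.vecMul, dotProduct] at h
    simp only [hM, Matrix.vandermonde_apply] at h
    rw [h, Pi.single_apply]
    simp [Fin.ext_iff]
  refine ⟨fun l => b l / ((k : ℝ) + 1), fun x => ?_⟩
  -- `⟨v + ε e_i, x⟩ = ⟨v,x⟩ + ε x_i`
  have hsingle : ∑ j, (Pi.single i (1 : ℝ) : ι → ℝ) j * x j = x i := by
    rw [Finset.sum_eq_single i (fun j _ hj => by rw [Pi.single_eq_of_ne hj, zero_mul])
      (fun h => absurd (Finset.mem_univ i) h), Pi.single_eq_same, one_mul]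
  have hlin : ∀ l : Fin (k + 2), ∑ j, (v + ((l : ℕ) : ℝ) • (Pi.single i (1 : ℝ) : ι → ℝ)) j * x j =
      (∑ j, v j * x j) + ε l * x i := by
    intro l
    have hj : ∀ j, (v + ((l : ℕ) : ℝ) • (Pi.single i (1 : ℝ) : ι → ℝ)) j * x j =
        v j * x j + ((l : ℕ) : ℝ) * ((Pi.single i (1 : ℝ) : ι → ℝ) j * x j) := by
      intro j; simp only [Pi.add_apply, Pi.smul_apply, smul_eq_mul]; ring
    rw [Finset.sum_congr rfl (fun j _ => hj j), Finset.sum_add_distrib, ← Finset.mul_sum, hsingle]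
  simp_rw [hlin]
  set A : ℝ := ∑ j, v j * x j with hA
  -- expand the binomials and use the moments
  have hexp : ∀ l : Fin (k + 2), (A + ε l * x i) ^ (k + 1) =
      ∑ m ∈ range (k + 2), A ^ m * x i ^ (k + 1 - m) * ((k + 1).choose m : ℝ) * ε l ^ (k + 1 - m) := by
    intro l
    rw [add_pow]
    refine Finset.sum_congr rfl fun m _ => ?_
    rw [mul_pow]; ring
  have hsum : ∑ l : Fin (k + 2), b l / ((k : ℝ) + 1) * (A + ε l * x i) ^ (k + 1) =
      (1 / ((k : ℝ) + 1)) * ∑ m ∈ range (k + 2), A ^ m * x i ^ (k + 1 - m) * ((k + 1).choose m : ℝ) *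
        (∑ l : Fin (k + 2), b l * ε l ^ (k + 1 - m)) := by
    simp_rw [hexp, Finset.mul_sum]
    rw [Finset.sum_comm]
    refine Finset.sum_congr rfl fun m _ => ?_
    exact Finset.sum_congr rfl fun l _ => by ring
  rw [hsum]
  have hmom' : ∀ m ∈ range (k + 2), A ^ m * x i ^ (k + 1 - m) * ((k + 1).choose m : ℝ) *
      (∑ l : Fin (k + 2), b l * ε l ^ (k + 1 - m)) =
      if m = k then A ^ k * x i * ((k : ℝ) + 1) else 0 := by
    intro m hm
    rw [Finset.mem_range] at hm
    rw [hmom (k + 1 - m) (by omega)]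
    by_cases hmk : m = k
    · rw [if_pos (by omega), if_pos hmk, hmk, show k + 1 - k = 1 by omega, pow_one, Nat.choose_succ_self_right]
      push_cast; ring
    · rw [if_neg (by omega), if_neg hmk, mul_zero]
  rw [Finset.sum_congr rfl hmom', Finset.sum_ite_eq' (range (k + 2)) k, if_pos (by simp)]
  have hk : ((k : ℝ) + 1) ≠ 0 := by positivity
  field_simp

/-- **Polarization**: every polynomial function on `ι → ℝ` is a finite linear combination of ridge powers `⟨v,x⟩^k`.
[folklore] -/
theorem eval_mvPolynomial_eq_sum_ridge_pow {ι : Type} [Fintype ι] [DecidableEq ι] (p : MvPolynomial ι ℝ) :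
    ∃ (κ : Type) (_ : Fintype κ) (c : κ → ℝ) (v : κ → ι → ℝ) (k : κ → ℕ),
      ∀ x : ι → ℝ, MvPolynomial.eval x p = ∑ l, c l * (∑ j, v l j * x j) ^ (k l) := by
  classical
  induction p using MvPolynomial.induction_on with
  | C a =>
    refine ⟨Unit, inferInstance, fun _ => a, fun _ => 0, fun _ => 0, fun x => ?_⟩
    simp
  | add p q hp hq =>
    obtain ⟨κ₁, _, c₁, v₁, k₁, h₁⟩ := hp
    obtain ⟨κ₂, _, c₂, v₂, k₂, h₂⟩ := hq
    refine ⟨κ₁ ⊕ κ₂, inferInstance, Sum.elim c₁ c₂, Sum.elim v₁ v₂, Sum.elim k₁ k₂, fun x => ?_⟩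
    rw [map_add, Fintype.sum_sum_type]
    simp only [Sum.elim_inl, Sum.elim_inr]
    rw [h₁ x, h₂ x]
  | mul_X p i hp =>
    obtain ⟨κ, _, c, v, k, h⟩ := hp
    -- for each term choose the Vandermonde coefficients
    choose a ha using fun l : κ => exists_coord_mul_ridge_pow (v l) i (k l)
    refine ⟨Σ l : κ, Fin (k l + 2), inferInstance, fun s => c s.1 * a s.1 s.2,
      fun s => v s.1 + ((s.2 : ℕ) : ℝ) • (Pi.single i (1 : ℝ) : ι → ℝ), fun s => k s.1 + 1, fun x => ?_⟩
    rw [map_mul, MvPolynomial.eval_X, h x, Finset.sum_mul, Fintype.sum_sigma]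
    refine Finset.sum_congr rfl fun l _ => ?_
    rw [mul_assoc, mul_comm ((∑ j, v l j * x j) ^ k l) (x i), ha l x, Finset.mul_sum]
    exact Finset.sum_congr rfl fun s _ => by ring

end Summit.QuantumFields.YangMills.Theorems.ColdStartUniversality

end
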